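import Literature.MathematicalPhysics.StatisticalMechanics.ComplexSpinGaussianDomination
import Literature.MathematicalPhysics.StatisticalMechanics.ComplexSpinTwistedPartitionFunction
import Literature.MathematicalPhysics.StatisticalMechanics.InfraredBoundSpectralStep
import HarnessLib

/-!
# Proof of the Salmhofer–Seiler infrared bound (CMP 139 (1991), Theorem 3.21): discharge of
# `SalmhoferSeiler1991_infraredBound`

Closing file of the series `ComplexSpinReflectionPositivity` (Prop. 3.15, Rem. 3.16),
`ComplexSpinExponentialSchwarz` (Thm. 3.20), `ComplexSpinChessboard` ((3.79)–(3.80), (3.94), (3.96),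
chessboard), `ComplexSpinGaussianDomination` ((3.84)–(3.90), (3.95), (3.97)),
`ComplexSpinTwistedPartitionFunction` ((3.78), (3.81)–(3.83)) and `InfraredBoundSpectralStep` (the
step "similar to [18]").  It proves `theorem SalmhoferSeiler1991_infraredBound_holds :
SalmhoferSeiler1991_infraredBound`, the named fact of `ComplexSpinInfraredBound` (Thm. 3.21 in the
case `F = e^{2Nmz}`, even torus `(ℤ/Lℤ)^ν`, `L ≥ 4`; see that file's docstring for the rendering).
The fact's own file cannot host the proof (the five proof files import it), hence this sibling.
Honest framing: a finite-volume inequality for a polynomial "spin system" at `β = 0`; nothing about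
`β > 0`, the continuum, or the summit's `QCD` conjunct.

WHAT IS PRINTED (p. 415, end of the proof of Thm. 3.21).  "Together with (3.82) and (3.83), this
means that for all `φ : Λ → ℝ`, `|⟨e^{N(σ,-Δφ)}⟩| ≤ e^{(N/2)(φ,-Δφ)}` (3.98) and
`|⟨e^{-iN(σ,Δ̄φ)}⟩| ≤ e^{(N/2)(φ,Δ̄φ)}` (3.99).  The rest of the proof is similar to the one in
[18]."  ([18] = Fröhlich–Simon–Spencer 1976: expand to second order in `φ ↦ tφ`, then diagonalise
by plane waves; cf. Friedli–Velenik §10.5.3, proof of Thm. 10.24.)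

HOW THE PROOF GOES HERE (all ingredients are theorems of the companion files).
* `coeff_two_le_of_abs_sum_le_exp`: if `|∑_{n≤D} p_n t^n| ≤ p_0 e^{ct²}` for all real `t`
  (`p_0, c ≥ 0`, `D ≥ 2`) then `p_2 ≤ c p_0` (elementary real analysis).
* Translation invariance of the bracket on the torus (`bracket_rename_addRight`,
  `bracket_X_mul_X_add`) and bilinearity `[σ(u)σ(v)] = ∑ u_x [σ_xσ_y] v_y`
  (`bracket_field_mul_field`).
* (3.82)/(3.83) made explicit: for a real `φ`, `linObs 1 N φ = N σ(-Δφ)`, `gaussConst 1 N φ =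
  -(N/2)(φ,-Δφ)`; for the imaginary configuration `iφ`, `linObs (-1) N (iφ) = -iN σ(Δ̄φ)`,
  `gaussConst (-1) N (iφ) = -(N/2)(φ,Δ̄φ)` (`sum_sq_link_eq` = summation by parts).
* `bracket_sq_field_stencil_negOne_le` / `neg_le_bracket_sq_field_stencil_one`: Gaussian domination
  (3.95)/(3.97) for the BACKGROUND system (`gaussianDomination_one/negOne` with site data
  `bgSite ε N ν f`, bond data `b = fluctCoeff N a ≥ 0`), rewritten through (3.81)
  (`twistedZ_bg_eq`, `twistedZ_bg_zero`) as `|[e_D^{tNσ(-Δφ)}]| ≤ Z e^{(N/2)t²(φ,-Δφ)}` resp. the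
  real part of `[e_D^{-itNσ(Δ̄φ)}]`, i.e. (3.98)/(3.99) for the unnormalised bracket, and to second
  order: `[σ(-Δφ)²] ≤ N⁻¹(φ,-Δφ) Z`, `[σ(Δ̄φ)²] ≥ -N⁻¹(φ,Δ̄φ) Z`.
* `form_le_of_stencil_form_le` (spectral step) turns these into (3.74)/(3.75) for `[·]`, and
  `⟨·⟩ = [·]/Z` with `Z ≥ 0` (`Z = 0`: the junk value `0` satisfies both bounds; `ν = 0`: `Δ = Δ̄ =
  0`).

## References

* M. Salmhofer, E. Seiler, *Proof of chiral symmetry breaking in strongly coupled lattice gauge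
  theory*, Commun. Math. Phys. 139 (1991) 395–432, Thm. 3.21, pp. 412–415. [SalmhoferSeiler1991]
* J. Fröhlich, B. Simon, T. Spencer, Commun. Math. Phys. 50 (1976) 79–95 (the paper's [18]).
  [FrohlichSimonSpencer1976]
* S. Friedli, Y. Velenik, *Statistical Mechanics of Lattice Systems*, CUP 2017, §10.5.3.
  [FriedliVelenik2017]
-/

noncomputable section

open MvPolynomial Finset

namespace Literature.MathematicalPhysics.StatisticalMechanics

open Literature.Probability.LatticeModels (TorusSite)
open Literature.Barriers.CriticalPhenomena.NonGibbs

namespace ComplexSpin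

variable {ν L : ℕ}

/-! ### Second order of an exponential-moment bound -/

/-- **Second-order extraction.**  If a real polynomial `q(t) = ∑_{n ≤ D} p_n t^n` (`D ≥ 2`) with
`p_0 ≥ 0` satisfies `|q(t)| ≤ p_0 e^{c t²}` for all real `t` (`c ≥ 0`), then `p_2 ≤ c p_0` — the
comparison of the `t²`-coefficients by which Gaussian domination (3.98)–(3.99) yields the infrared
bound ("the rest of the proof is similar to the one in [18]"; in [18] and in Friedli–Velenik's
rendering: `∂²/∂λ² Z(λh)|_{λ=0} ≤ 0`).  Elementary: `e^{x} ≤ 1 + x + x²` for `|x| ≤ 1`, the odd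
part cancels under `t ↦ -t`, and `(p_2 - c p_0) t² ≤ K|t|³` for small `t` forces `p_2 ≤ c p_0`.
[cite: FriedliVelenik2017, §10.5.3 (proof of Thm. 10.24, (10.46))] -/
theorem coeff_two_le_of_abs_sum_le_exp {D : ℕ} (hD : 2 ≤ D) (p : ℕ → ℝ) {c : ℝ} (hc : 0 ≤ c)
    (hp0 : 0 ≤ p 0)
    (h : ∀ t : ℝ, |∑ n ∈ range (D + 1), p n * t ^ n| ≤ p 0 * Real.exp (c * t ^ 2)) :
    p 2 ≤ c * p 0 := by
  -- the remainder `R(t)` of `q(t) = p_0 + p_1 t + p_2 t² + t³ R(t)` and its bound `M` on `|t| ≤ 1`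
  set M : ℝ := ∑ n ∈ range (D + 1), |p n| with hM
  have hM0 : 0 ≤ M := Finset.sum_nonneg fun n _ => abs_nonneg _
  set R : ℝ → ℝ := fun t => ∑ n ∈ range (D + 1), (if 3 ≤ n then p n * t ^ (n - 3) else 0) with hR
  have hdecomp : ∀ t : ℝ, ∑ n ∈ range (D + 1), p n * t ^ n =
      p 0 + p 1 * t + p 2 * t ^ 2 + t ^ 3 * R t := by
    intro t
    have hsplit : ∑ n ∈ range (D + 1), p n * t ^ n =
        ∑ n ∈ range (D + 1), (if n < 3 then p n * t ^ n else 0) +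
          ∑ n ∈ range (D + 1), (if 3 ≤ n then p n * t ^ n else 0) := by
      rw [← Finset.sum_add_distrib]
      refine Finset.sum_congr rfl fun n _ => ?_
      by_cases hn : n < 3
      · rw [if_pos hn, if_neg (by omega), add_zero]
      · rw [if_neg hn, if_pos (by omega), zero_add]
    have hlow : ∑ n ∈ range (D + 1), (if n < 3 then p n * t ^ n else 0) =
        p 0 + p 1 * t + p 2 * t ^ 2 := by
      rw [← Finset.sum_filter]
      have hf : (range (D + 1)).filter (fun n => n < 3) = range 3 := by
        ext n
        simp only [Finset.mem_filter, Finset.mem_range]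
        omega
      rw [hf, Finset.sum_range_succ, Finset.sum_range_succ, Finset.sum_range_succ, Finset.sum_range_zero]
      ring
    have hhigh : ∑ n ∈ range (D + 1), (if 3 ≤ n then p n * t ^ n else 0) = t ^ 3 * R t := by
      rw [hR, Finset.mul_sum]
      refine Finset.sum_congr rfl fun n _ => ?_
      split_ifs with hn
      · rw [show p n * t ^ n = p n * (t ^ 3 * t ^ (n - 3)) by rw [← pow_add, show 3 + (n - 3) = n by omega]]
        ring
      · rw [mul_zero]
    rw [hsplit, hlow, hhigh]
  have hRbound : ∀ t : ℝ, |t| ≤ 1 → |R t| ≤ M := by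
    intro t ht
    rw [hR, hM]
    refine (Finset.abs_sum_le_sum_abs _ _).trans (Finset.sum_le_sum fun n _ => ?_)
    split_ifs
    · rw [abs_mul, abs_pow]
      exact mul_le_of_le_one_right (abs_nonneg _) (pow_le_one₀ (abs_nonneg _) ht)
    · rw [abs_zero]; exact abs_nonneg _
  -- the window `|t| ≤ δ` on which `e^{ct²} ≤ 1 + ct² + c²t⁴`
  set δ : ℝ := 1 / (c + 1) with hδ
  have hc1 : 0 < c + 1 := by linarith
  have hδ0 : 0 < δ := by rw [hδ]; positivity
  have hδ1 : δ ≤ 1 := by rw [hδ, div_le_one hc1]; linarith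
  set K : ℝ := p 0 * c ^ 2 + M with hK
  have hK0 : 0 ≤ K := by positivity
  have star : ∀ t : ℝ, |t| ≤ δ → p 1 * t + (p 2 - c * p 0) * t ^ 2 ≤ K * |t| ^ 3 := by
    intro t ht
    have ht1 : |t| ≤ 1 := ht.trans hδ1
    have ht2 : t ^ 2 ≤ δ := by
      have h1 : t ^ 2 = |t| ^ 2 := (sq_abs t).symm
      have h2 : |t| ^ 2 ≤ δ ^ 2 := pow_le_pow_left₀ (abs_nonneg t) ht 2
      nlinarith
    have hct : c * t ^ 2 ≤ 1 := by
      calc c * t ^ 2 ≤ c * δ := mul_le_mul_of_nonneg_left ht2 hc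
        _ = c / (c + 1) := by rw [hδ]; ring
        _ ≤ 1 := by rw [div_le_one hc1]; linarith
    have hexp : Real.exp (c * t ^ 2) ≤ 1 + c * t ^ 2 + c ^ 2 * t ^ 4 := by
      have h1 := Real.abs_exp_sub_one_sub_id_le (x := c * t ^ 2)
        (by rw [abs_of_nonneg (by positivity)]; exact hct)
      have h2 := (abs_le.1 h1).2
      nlinarith
    have hq : ∑ n ∈ range (D + 1), p n * t ^ n ≤ p 0 * (1 + c * t ^ 2 + c ^ 2 * t ^ 4) :=
      (le_abs_self _).trans ((h t).trans (mul_le_mul_of_nonneg_left hexp hp0))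
    rw [hdecomp] at hq
    have hR3 : -(t ^ 3 * R t) ≤ |t| ^ 3 * M := by
      have h1 : |t ^ 3 * R t| ≤ |t| ^ 3 * M := by
        rw [abs_mul, abs_pow]
        exact mul_le_mul_of_nonneg_left (hRbound t ht1) (by positivity)
      have h2 := neg_abs_le (t ^ 3 * R t)
      linarith
    have ht4 : t ^ 4 ≤ |t| ^ 3 := by
      have h1 : t ^ 4 = |t| ^ 4 := by rw [← abs_pow, abs_of_nonneg (by positivity)]
      rw [h1]
      exact pow_le_pow_of_le_one (abs_nonneg _) ht1 (by norm_num)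
    have h5 : p 0 * c ^ 2 * t ^ 4 ≤ p 0 * c ^ 2 * |t| ^ 3 :=
      mul_le_mul_of_nonneg_left ht4 (by positivity)
    rw [hK]
    nlinarith [hq, hR3, h5]
  -- symmetrise in `t ↦ -t`: `(p 2 - c p 0) t² ≤ K t³` for `0 < t ≤ δ`
  have key : ∀ t : ℝ, 0 < t → t ≤ δ → p 2 - c * p 0 ≤ K * t := by
    intro t ht htδ
    have h1 := star t (by rw [abs_of_pos ht]; exact htδ)
    have h2 := star (-t) (by rw [abs_neg, abs_of_pos ht]; exact htδ)
    rw [abs_of_pos ht] at h1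
    rw [abs_neg, abs_of_pos ht] at h2
    have h3 : (p 2 - c * p 0) * t ^ 2 ≤ (K * t) * t ^ 2 := by nlinarith
    exact le_of_mul_le_mul_right h3 (by positivity)
  by_contra hcon
  rw [not_le] at hcon
  have hdpos : 0 < p 2 - c * p 0 := by linarith
  set t₀ : ℝ := min δ ((p 2 - c * p 0) / (2 * (K + 1))) with ht₀
  have ht₀pos : 0 < t₀ := lt_min hδ0 (by positivity)
  have h1 := key t₀ ht₀pos (min_le_left _ _)
  have h2 : K * t₀ ≤ K * ((p 2 - c * p 0) / (2 * (K + 1))) :=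
    mul_le_mul_of_nonneg_left (min_le_right _ _) hK0
  have h3 : K * ((p 2 - c * p 0) / (2 * (K + 1))) < p 2 - c * p 0 := by
    rw [← mul_div_assoc, div_lt_iff₀ (by positivity)]
    nlinarith
  linarith

variable [NeZero L]

/-! ### The two-point function of the real complex spin system and its symmetries -/

/-- The real bracket `[·]_Λ` is additive. [cite: SalmhoferSeiler1991, (3.1)–(3.2) and Remark 3.2] -/
theorem bracket_add (N : ℕ) (m : ℝ) (a : ℕ → ℝ) (Φ Ψ : MvPolynomial (TorusSite ν L) ℝ) :
    bracket N m a (Φ + Ψ) = bracket N m a Φ + bracket N m a Ψ := by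
  rw [bracket, bracket, bracket, add_mul, coeff_add]

/-- `[∑ Φ_a]_Λ = ∑ [Φ_a]_Λ`. [cite: SalmhoferSeiler1991, (3.1)–(3.2) and Remark 3.2] -/
theorem bracket_sum (N : ℕ) (m : ℝ) (a : ℕ → ℝ) {α : Type*} (s : Finset α)
    (Φ : α → MvPolynomial (TorusSite ν L) ℝ) :
    bracket N m a (∑ b ∈ s, Φ b) = ∑ b ∈ s, bracket N m a (Φ b) := by
  rw [bracket, Finset.sum_mul, coeff_sum]
  rfl

/-- `[c Φ]_Λ = c [Φ]_Λ`. [cite: SalmhoferSeiler1991, (3.1)–(3.2) and Remark 3.2] -/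
theorem bracket_C_mul (N : ℕ) (m : ℝ) (a : ℕ → ℝ) (c : ℝ) (Φ : MvPolynomial (TorusSite ν L) ℝ) :
    bracket N m a (C c * Φ) = c * bracket N m a Φ := by
  rw [bracket, bracket, mul_assoc, coeff_C_mul]

/-- **Bilinearity**: `[σ(u) σ(v)]_Λ = ∑_{x,y} u_x [σ_x σ_y]_Λ v_y` — the two-point function
`G(x,y) = [σ_x σ_y]_Λ` as a kernel. [cite: SalmhoferSeiler1991, (3.77) and (3.100)] -/
theorem bracket_field_mul_field (N : ℕ) (m : ℝ) (a : ℕ → ℝ) (u v : TorusSite ν L → ℝ) :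
    bracket N m a (field u * field v) = ∑ x, ∑ y, u x * bracket N m a (X x * X y) * v y := by
  unfold field
  rw [Finset.sum_mul_sum, bracket_sum]
  refine Finset.sum_congr rfl fun x _ => ?_
  rw [bracket_sum]
  refine Finset.sum_congr rfl fun y _ => ?_
  rw [show C (u x) * X x * (C (v y) * X y) = C (u x * v y) * (X x * X y) by rw [map_mul]; ring,
    bracket_C_mul]
  ring

/-- `σ(t ℓ) = t σ(ℓ)`. [cite: SalmhoferSeiler1991, (3.77)] -/
theorem field_smul (t : ℝ) (ℓ : TorusSite ν L → ℝ) :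
    field (fun x => t * ℓ x) = C t * field ℓ := by
  unfold field
  rw [Finset.mul_sum]
  exact Finset.sum_congr rfl fun x _ => by rw [map_mul, mul_assoc]

/-- The two-point function `[σ_x σ_y]_Λ` is symmetric. [cite: SalmhoferSeiler1991, (3.100)] -/
theorem bracket_X_mul_X_comm (N : ℕ) (m : ℝ) (a : ℕ → ℝ) (x y : TorusSite ν L) :
    bracket N m a (X x * X y) = bracket N m a (X y * X x) := by
  rw [mul_comm]

/-- Translating the Boltzmann polynomial of the torus reproduces it. [cite: SalmhoferSeiler1991, Def. 3.1 (torus)] -/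
theorem rename_addRight_boltzmann (N : ℕ) (m : ℝ) (a : ℕ → ℝ) (c : TorusSite ν L) :
    rename (fun x : TorusSite ν L => x + c) (boltzmann (ν := ν) (L := L) N m a) = boltzmann N m a := by
  unfold boltzmann
  rw [map_mul, map_prod, map_prod]
  have hs : ∀ x : TorusSite ν L, rename (fun x : TorusSite ν L => x + c) (siteWeight N m x) =
      siteWeight N m (x + c) := fun x => by
    simp [siteWeight, map_sum, map_mul, map_pow, rename_X]
  have hb : ∀ x y : TorusSite ν L, rename (fun x : TorusSite ν L => x + c) (bondWeight N a x y) =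
      bondWeight N a (x + c) (y + c) := fun x y => by
    simp [bondWeight, map_sum, map_mul, map_pow, rename_X]
  simp_rw [map_prod, hs, hb]
  congr 1
  · exact Fintype.prod_equiv (Equiv.addRight c) _ _ fun x => rfl
  · refine Fintype.prod_equiv (Equiv.addRight c) _ _ fun x => ?_
    refine Finset.prod_congr rfl fun μ _ => ?_
    rw [Equiv.coe_addRight, add_right_comm]

/-- The top exponent is translation invariant. [cite: SalmhoferSeiler1991, Remark 3.2] -/
theorem mapDomain_addRight_topExponent (N : ℕ) (c : TorusSite ν L) :
    (topExponent (ν := ν) (L := L) N).mapDomain (fun x : TorusSite ν L => x + c) = topExponent N := by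
  ext y
  obtain ⟨x, rfl⟩ : ∃ x, x + c = y := ⟨y - c, sub_add_cancel y c⟩
  rw [Finsupp.mapDomain_apply (add_left_injective c)]
  simp [topExponent]

/-- **Translation invariance of the bracket**: `[Φ(σ_{·+c})]_Λ = [Φ]_Λ`. [cite: SalmhoferSeiler1991, Def. 3.1 (torus) and Remark 3.2] -/
theorem bracket_rename_addRight (N : ℕ) (m : ℝ) (a : ℕ → ℝ) (c : TorusSite ν L)
    (Φ : MvPolynomial (TorusSite ν L) ℝ) :
    bracket N m a (rename (fun x : TorusSite ν L => x + c) Φ) = bracket N m a Φ := by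
  unfold bracket
  conv_lhs => rw [← rename_addRight_boltzmann N m a c, ← map_mul,
    ← mapDomain_addRight_topExponent N c]
  exact coeff_rename_mapDomain _ (Equiv.addRight c).injective _ _

/-- **Translation invariance of the two-point function**: `[σ_{x+c} σ_{y+c}]_Λ = [σ_x σ_y]_Λ`
(`T_Λ(x) = ⟨σ_y σ_{y+x}⟩_Λ`, (3.100)). [cite: SalmhoferSeiler1991, (3.100)] -/
theorem bracket_X_mul_X_add (N : ℕ) (m : ℝ) (a : ℕ → ℝ) (x y c : TorusSite ν L) :
    bracket N m a (X (x + c) * X (y + c)) = bracket N m a (X x * X y) := by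
  rw [← bracket_rename_addRight N m a c (X x * X y), map_mul, rename_X, rename_X]

/-! ### The linear observable and the Gaussian constant for real and imaginary configurations -/

omit [NeZero L] in
/-- The stencil is linear: `T(tφ) = t Tφ`. [cite: SalmhoferSeiler1991, (3.76)] -/
theorem stencil_smul (s t : ℝ) (φ : TorusSite ν L → ℝ) (x : TorusSite ν L) :
    stencil s (fun y => t * φ y) x = t * stencil s φ x := by
  unfold stencil
  rw [Finset.mul_sum]
  exact Finset.sum_congr rfl fun μ _ => by ring

/-- **Summation by parts on the torus**: `∑_{x,μ} (φ_x + sφ_{x+e_μ})² = (φ, T_s φ)` for `s = ±1`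
(`(φ, -Δφ) = ∑ (φ_x - φ_{x+e_μ})²`, `(φ, Δ̄φ) = ∑ (φ_x + φ_{x+e_μ})²`). [cite: SalmhoferSeiler1991, (3.76)–(3.77) and (3.81)–(3.83)] -/
theorem sum_sq_link_eq (s : ℝ) (hs : s = 1 ∨ s = -1) (φ : TorusSite ν L → ℝ) :
    ∑ x, ∑ μ : Fin ν, (φ x + s * φ (x + Pi.single μ 1)) ^ 2 = ∑ x, φ x * stencil s φ x := by
  have hs2 : s * s = 1 := by rcases hs with h | h <;> simp [h]
  have hR : ∑ x, φ x * stencil s φ x = ∑ μ : Fin ν, ∑ x : TorusSite ν L,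
      (2 * (φ x * φ x) + s * (φ x * φ (x + Pi.single μ 1)) + s * (φ x * φ (x - Pi.single μ 1))) := by
    unfold stencil
    rw [Finset.sum_comm]
    refine Finset.sum_congr rfl fun x _ => ?_
    rw [Finset.mul_sum]
    exact Finset.sum_congr rfl fun μ _ => by ring
  have hL' : ∑ x, ∑ μ : Fin ν, (φ x + s * φ (x + Pi.single μ 1)) ^ 2 =
      ∑ μ : Fin ν, ∑ x : TorusSite ν L, (φ x * φ x + 2 * s * (φ x * φ (x + Pi.single μ 1)) +
        (s * s) * (φ (x + Pi.single μ 1) * φ (x + Pi.single μ 1))) := by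
    rw [Finset.sum_comm]
    exact Finset.sum_congr rfl fun μ _ => Finset.sum_congr rfl fun x _ => by ring
  rw [hL', hR, hs2]
  refine Finset.sum_congr rfl fun μ _ => ?_
  have hshift : ∑ x : TorusSite ν L, φ (x + Pi.single μ 1) * φ (x + Pi.single μ 1) =
      ∑ x : TorusSite ν L, φ x * φ x :=
    Fintype.sum_equiv (Equiv.addRight (Pi.single μ 1)) _ _ fun x => rfl
  have hshift' : ∑ x : TorusSite ν L, φ x * φ (x - Pi.single μ 1) =
      ∑ x : TorusSite ν L, φ (x + Pi.single μ 1) * φ x :=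
    Fintype.sum_equiv (Equiv.subRight (Pi.single μ 1)) _ _ fun x => by
      simp only [Equiv.subRight_apply, sub_add_cancel]
  have e3 : ∑ x : TorusSite ν L, φ (x + Pi.single μ 1) * φ x =
      ∑ x : TorusSite ν L, φ x * φ (x + Pi.single μ 1) :=
    Finset.sum_congr rfl fun x _ => mul_comm _ _
  simp only [Finset.sum_add_distrib, ← Finset.mul_sum]
  rw [hshift, hshift', e3]
  ring

/-- The linear observable of a real configuration for `ε = 1` is `N σ(-Δφ)` (3.82).
[cite: SalmhoferSeiler1991, (3.82)] -/
theorem linObs_one_ofReal (N : ℕ) (φ : TorusSite ν L → ℝ) :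
    linObs 1 N (fun y => (φ y : ℂ)) =
      MvPolynomial.map Complex.ofRealHom (field fun x => (N : ℝ) * stencil (-1) φ x) := by
  unfold linObs field
  rw [map_sum]
  refine Finset.sum_congr rfl fun x _ => ?_
  rw [map_mul, map_X, map_C]
  congr 2
  simp only [linCoeff, linkCfg, stencil, Int.cast_one, one_mul, mul_one, Complex.ofRealHom_eq_coe]
  push_cast
  rw [Finset.mul_sum, Finset.mul_sum]
  exact Finset.sum_congr rfl fun μ _ => by ring

/-- The linear observable of an imaginary configuration `iφ` for `ε = -1` is `-iN σ(Δ̄φ)` (3.83)/(3.99).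
[cite: SalmhoferSeiler1991, (3.83) and (3.99)] -/
theorem linObs_negOne_I (N : ℕ) (φ : TorusSite ν L → ℝ) :
    linObs (-1) N (fun y => (φ y : ℂ) * Complex.I) =
      C (-Complex.I) * MvPolynomial.map Complex.ofRealHom (field fun x => (N : ℝ) * stencil 1 φ x) := by
  unfold linObs field
  rw [map_sum, Finset.mul_sum]
  refine Finset.sum_congr rfl fun x _ => ?_
  rw [map_mul, map_X, map_C, ← mul_assoc, ← map_mul]
  congr 2
  simp only [linCoeff, linkCfg, stencil, Int.cast_neg, Int.cast_one, Complex.ofRealHom_eq_coe]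
  push_cast
  rw [Finset.mul_sum, Finset.mul_sum, Finset.mul_sum]
  exact Finset.sum_congr rfl fun μ _ => by ring

/-- The Gaussian constant of a real configuration for `ε = 1` is `-(N/2)(φ, -Δφ)` (3.82).
[cite: SalmhoferSeiler1991, (3.82)] -/
theorem gaussConst_one_ofReal (N : ℕ) (φ : TorusSite ν L → ℝ) :
    gaussConst 1 N (fun y => (φ y : ℂ)) =
      ((-((N : ℝ) / 2) * ∑ x, φ x * stencil (-1) φ x : ℝ) : ℂ) := by
  rw [← sum_sq_link_eq (-1) (Or.inr rfl) φ]
  simp only [gaussConst, linkCfg, Int.cast_one, one_mul]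
  push_cast
  ring

/-- The Gaussian constant of an imaginary configuration `iφ` for `ε = -1` is `-(N/2)(φ, Δ̄φ)`
((3.83) at `iφ`, (3.99)). [cite: SalmhoferSeiler1991, (3.83) and (3.99)] -/
theorem gaussConst_negOne_I (N : ℕ) (φ : TorusSite ν L → ℝ) :
    gaussConst (-1) N (fun y => (φ y : ℂ) * Complex.I) =
      ((-((N : ℝ) / 2) * ∑ x, φ x * stencil 1 φ x : ℝ) : ℂ) := by
  rw [← sum_sq_link_eq 1 (Or.inl rfl) φ]
  simp only [gaussConst, linkCfg, Int.cast_neg, Int.cast_one, one_mul]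
  push_cast
  have h : ∀ (x : TorusSite ν L) (μ : Fin ν),
      ((φ x : ℂ) * Complex.I - -1 * ((φ (x + Pi.single μ 1) : ℂ) * Complex.I)) ^ 2 =
        -(((φ x : ℂ) + (φ (x + Pi.single μ 1) : ℂ)) ^ 2) := by
    intro x μ
    have hI : Complex.I ^ 2 = -1 := Complex.I_sq
    linear_combination (((φ x : ℂ) + (φ (x + Pi.single μ 1) : ℂ)) ^ 2) * hI
  simp_rw [h, Finset.sum_neg_distrib]
  ring

/-- **The bracket of the truncated exponential of a scaled linear observable is a polynomial in the
scale**: `[e_D^{z σ(ℓ)}]_Λ = ∑_{n ≤ D} z^n [σ(ℓ)^n]_Λ / n!` (original system, complexified).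
[cite: SalmhoferSeiler1991, (3.82)–(3.83) and (3.98)–(3.99)] -/
theorem bracketC_eT_C_mul_map_field (N : ℕ) (m : ℝ) (a : ℕ → ℝ) (z : ℂ) (ℓ : TorusSite ν L → ℝ) :
    bracketC N (fun j => (2 * N * m) ^ j / (Nat.factorial j : ℝ)) a
        (eT (topDegree ν L N) (C z * MvPolynomial.map Complex.ofRealHom (field ℓ))) =
      ∑ n ∈ range (topDegree ν L N + 1),
        z ^ n * ((bracket N m a (field ℓ ^ n) / (n.factorial : ℝ) : ℝ) : ℂ) := by
  unfold eT
  rw [bracketC_sum]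
  refine Finset.sum_congr rfl fun n _ => ?_
  rw [bracketC_C_mul, mul_pow, ← map_pow C, bracketC_C_mul, ← map_pow, ← bracket_eq_bracketC]
  push_cast
  ring

/-! ### Gaussian domination to second order: the two quadratic-form bounds -/

/-- `|Λ| ≥ 2` gives `2N ≤ N|Λ|` and `2 ≤ N|Λ|` (`N ≥ 1`). [cite: SalmhoferSeiler1991, Remark 3.2] -/
theorem two_mul_le_topDegree {N : ℕ} (hcard : 2 ≤ Fintype.card (TorusSite ν L)) :
    2 * N ≤ topDegree ν L N := by
  rw [topDegree, mul_comm]; exact Nat.mul_le_mul_left N hcard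

/-- The partition function `Z_Λ` is the twisted partition function at `φ = 0` of the background system,
hence real `≥ 0` (torus of positive dimension). [cite: SalmhoferSeiler1991, (3.80)–(3.81) and (3.90)] -/
theorem partitionFunction_nonneg' (hL : Even L) (i : Fin ν) (hcard : 2 ≤ Fintype.card (TorusSite ν L))
    (ε : ℤ) (hε : ε = 1 ∨ ε = -1) {N : ℕ} (m : ℝ) {a : ℕ → ℝ} (hb : ∀ k ≤ N, 0 ≤ fluctCoeff N a k) :
    0 ≤ partitionFunction (ν := ν) (L := L) N m a ∧
      twistedZ ε N (bgSite ε N ν fun j => (2 * N * m) ^ j / (Nat.factorial j : ℝ)) (fluctCoeff N a)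
        (fun _ : TorusSite ν L => (0 : ℂ)) = ((partitionFunction (ν := ν) (L := L) N m a : ℝ) : ℂ) := by
  have hz := twistedZ_bg_zero (ν := ν) (L := L) ε hε (N := N) (two_mul_le_topDegree hcard)
    (fun j => (2 * N * m) ^ j / (Nat.factorial j : ℝ)) a
  have hZ : twistedZ ε N (bgSite ε N ν fun j => (2 * N * m) ^ j / (Nat.factorial j : ℝ)) (fluctCoeff N a)
      (fun _ : TorusSite ν L => (0 : ℂ)) = ((partitionFunction (ν := ν) (L := L) N m a : ℝ) : ℂ) := by
    rw [hz, partitionFunction, bracket_eq_bracketC, map_one]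
  refine ⟨?_, hZ⟩
  have h := (twistedZ_zero_real hL i 0 ε (bgSite ε N ν fun j => (2 * N * m) ^ j / (Nat.factorial j : ℝ)) hb).2
  rwa [hZ, Complex.ofReal_re] at h

/-- **(3.98) to second order**: `[σ(-Δφ)²]_Λ ≤ N⁻¹ (φ, -Δφ) Z_Λ` for every real `φ` — Gaussian
domination (3.95) for the background system, the identification (3.81)/(3.82) with the original
system, and comparison of the `t²`-coefficients in `|⟨e^{tN(σ,-Δφ)}⟩| ≤ e^{(N/2)t²(φ,-Δφ)}`.
[cite: SalmhoferSeiler1991, (3.82), (3.95), (3.98)] -/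
theorem bracket_sq_field_stencil_negOne_le (hL : Even L) (i : Fin ν)
    (hcard : 2 ≤ Fintype.card (TorusSite ν L)) {N : ℕ} (hN : 1 ≤ N) (m : ℝ) {a : ℕ → ℝ}
    (hb : ∀ k ≤ N, 0 ≤ fluctCoeff N a k) (φ : TorusSite ν L → ℝ) :
    bracket N m a (field (stencil (-1) φ) ^ 2) ≤
      (1 / N) * (∑ x, φ x * stencil (-1) φ x) * partitionFunction (ν := ν) (L := L) N m a := by
  set f : ℕ → ℝ := fun j => (2 * N * m) ^ j / (Nat.factorial j : ℝ) with hf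
  set ℓ : TorusSite ν L → ℝ := fun x => (N : ℝ) * stencil (-1) φ x with hℓ
  set Q : ℝ := ∑ x, φ x * stencil (-1) φ x with hQ
  set Z : ℝ := partitionFunction (ν := ν) (L := L) N m a with hZdef
  obtain ⟨hZ0, hZ⟩ := partitionFunction_nonneg' hL i hcard 1 (Or.inl rfl) m hb
  have hD2 := two_mul_le_topDegree (N := N) hcard
  have hQ0 : 0 ≤ Q := by
    rw [hQ, ← sum_sq_link_eq (-1) (Or.inr rfl) φ]; positivity
  have hNpos : (0 : ℝ) < N := Nat.cast_pos.2 hN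
  -- the polynomial `t ↦ [e_D^{t σ(ℓ)}]` and its exponential bound
  set p : ℕ → ℝ := fun n => bracket N m a (field ℓ ^ n) / (n.factorial : ℝ) with hp
  have hp0 : p 0 = Z := by simp [hp, hZdef, partitionFunction]
  have hbound : ∀ t : ℝ, |∑ n ∈ range (topDegree ν L N + 1), p n * t ^ n| ≤
      p 0 * Real.exp ((N : ℝ) / 2 * Q * t ^ 2) := by
    intro t
    set φt : TorusSite ν L → ℂ := fun y => (((t * φ y : ℝ)) : ℂ) with hφt
    have hgd := gaussianDomination_one hL (bgSite 1 N ν f) hb (φ := φt)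
      (fun y => by rw [hφt]; exact Complex.conj_ofReal _)
    rw [hZ, twistedZ_bg_eq 1 (Or.inl rfl) hD2 f a φt] at hgd
    have hg : gaussConst 1 N φt = ((-((N : ℝ) / 2) * Q * t ^ 2 : ℝ) : ℂ) := by
      rw [hφt, gaussConst_one_ofReal]
      congr 1
      simp only [stencil_smul]
      rw [show -((N : ℝ) / 2) * Q * t ^ 2 = (-((N : ℝ) / 2) * t ^ 2) * Q by ring, hQ,
        Finset.mul_sum, Finset.mul_sum]
      exact Finset.sum_congr rfl fun x _ => by ring
    have hlin : linObs 1 N φt = C ((t : ℝ) : ℂ) * MvPolynomial.map Complex.ofRealHom (field ℓ) := by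
      rw [hφt, linObs_one_ofReal]
      have : (fun x => (N : ℝ) * stencil (-1) (fun y => t * φ y) x) = fun x => t * ℓ x := by
        funext x; rw [stencil_smul, hℓ]; ring
      rw [this, field_smul, map_mul, map_C]
      rfl
    rw [hg, hlin, bracketC_eT_C_mul_map_field, norm_mul, Complex.norm_exp, Complex.ofReal_re,
      Complex.norm_real, Real.norm_of_nonneg hZ0] at hgd
    have hsum : ∑ n ∈ range (topDegree ν L N + 1), ((t : ℝ) : ℂ) ^ n *
        ((bracket N m a (field ℓ ^ n) / (n.factorial : ℝ) : ℝ) : ℂ) =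
        ((∑ n ∈ range (topDegree ν L N + 1), p n * t ^ n : ℝ) : ℂ) := by
      push_cast
      exact Finset.sum_congr rfl fun n _ => by rw [hp]; push_cast; ring
    rw [hsum, Complex.norm_real, Real.norm_eq_abs] at hgd
    rw [hp0]
    have hexp : 0 < Real.exp (-((N : ℝ) / 2) * Q * t ^ 2) := Real.exp_pos _
    have h3 := (le_div_iff₀' hexp).2 hgd
    rw [div_eq_mul_inv, ← Real.exp_neg,
      show -(-((N : ℝ) / 2) * Q * t ^ 2) = (N : ℝ) / 2 * Q * t ^ 2 by ring] at h3
    calc |∑ n ∈ range (topDegree ν L N + 1), p n * t ^ n|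
        ≤ partitionFunction (ν := ν) (L := L) N m a * Real.exp ((N : ℝ) / 2 * Q * t ^ 2) := h3
      _ = Z * Real.exp ((N : ℝ) / 2 * Q * t ^ 2) := by rw [hZdef]
  have h2 := coeff_two_le_of_abs_sum_le_exp (le_trans (by omega) hD2) p
    (by positivity : 0 ≤ (N : ℝ) / 2 * Q) (by rw [hp0]; exact hZ0) hbound
  rw [hp0] at h2
  simp only [hp, Nat.factorial_two, Nat.cast_ofNat] at h2
  -- `[σ(ℓ)²] = N² [σ(Tφ)²]`
  have hℓ2 : bracket N m a (field ℓ ^ 2) = (N : ℝ) ^ 2 * bracket N m a (field (stencil (-1) φ) ^ 2) := by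
    rw [hℓ, field_smul, mul_pow, ← map_pow, bracket_C_mul]
  rw [hℓ2] at h2
  have h3 : (N : ℝ) * bracket N m a (field (stencil (-1) φ) ^ 2) ≤ Q * Z :=
    le_of_mul_le_mul_left (by linarith) hNpos
  have h4 : bracket N m a (field (stencil (-1) φ) ^ 2) ≤ Q * Z / N := (le_div_iff₀' hNpos).2 h3
  calc bracket N m a (field (stencil (-1) φ) ^ 2) ≤ Q * Z / N := h4
    _ = 1 / N * Q * Z := by ring

/-- **(3.99) to second order**: `[σ(Δ̄φ)²]_Λ ≥ -N⁻¹ (φ, Δ̄φ) Z_Λ` for every real `φ` — Gaussian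
domination (3.97) at the imaginary configuration `iφ`, the identification (3.81)/(3.83), and the real
part of `|⟨e^{-itN(σ,Δ̄φ)}⟩| ≤ e^{(N/2)t²(φ,Δ̄φ)}` to second order.
[cite: SalmhoferSeiler1991, (3.83), (3.97), (3.99)] -/
theorem neg_le_bracket_sq_field_stencil_one (hL : Even L) (i : Fin ν)
    (hcard : 2 ≤ Fintype.card (TorusSite ν L)) {N : ℕ} (hN : 1 ≤ N) (m : ℝ) {a : ℕ → ℝ}
    (hb : ∀ k ≤ N, 0 ≤ fluctCoeff N a k) (φ : TorusSite ν L → ℝ) :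
    -((1 / N) * (∑ x, φ x * stencil 1 φ x) * partitionFunction (ν := ν) (L := L) N m a) ≤
      bracket N m a (field (stencil 1 φ) ^ 2) := by
  set f : ℕ → ℝ := fun j => (2 * N * m) ^ j / (Nat.factorial j : ℝ) with hf
  set ℓ : TorusSite ν L → ℝ := fun x => (N : ℝ) * stencil 1 φ x with hℓ
  set Q : ℝ := ∑ x, φ x * stencil 1 φ x with hQ
  set Z : ℝ := partitionFunction (ν := ν) (L := L) N m a with hZdef
  obtain ⟨hZ0, hZ⟩ := partitionFunction_nonneg' hL i hcard (-1) (Or.inr rfl) m hb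
  have hD2 := two_mul_le_topDegree (N := N) hcard
  have hQ0 : 0 ≤ Q := by
    rw [hQ, ← sum_sq_link_eq 1 (Or.inl rfl) φ]; positivity
  have hNpos : (0 : ℝ) < N := Nat.cast_pos.2 hN
  -- the real parts `p_n = Re((-i)^n) [σ(ℓ)^n]/n!`
  set p : ℕ → ℝ := fun n => ((-Complex.I) ^ n).re * (bracket N m a (field ℓ ^ n) / (n.factorial : ℝ))
    with hp
  have hp0 : p 0 = Z := by simp [hp, hZdef, partitionFunction]
  have hbound : ∀ t : ℝ, |∑ n ∈ range (topDegree ν L N + 1), p n * t ^ n| ≤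
      p 0 * Real.exp ((N : ℝ) / 2 * Q * t ^ 2) := by
    intro t
    set φt : TorusSite ν L → ℂ := fun y => (((t * φ y : ℝ)) : ℂ) * Complex.I with hφt
    have hgd := gaussianDomination_negOne hL (bgSite (-1) N ν f) hb (φ := φt)
      (fun y => by rw [hφt, map_mul, Complex.conj_ofReal, Complex.conj_I, mul_neg])
    rw [hZ, twistedZ_bg_eq (-1) (Or.inr rfl) hD2 f a φt] at hgd
    have hg : gaussConst (-1) N φt = ((-((N : ℝ) / 2) * Q * t ^ 2 : ℝ) : ℂ) := by
      rw [hφt]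
      have := gaussConst_negOne_I (ν := ν) (L := L) N (fun y => t * φ y)
      rw [show (fun y : TorusSite ν L => (((t * φ y : ℝ)) : ℂ) * Complex.I) =
          fun y => (((fun y => t * φ y) y : ℝ) : ℂ) * Complex.I from rfl, this]
      congr 1
      simp only [stencil_smul]
      rw [show -((N : ℝ) / 2) * Q * t ^ 2 = (-((N : ℝ) / 2) * t ^ 2) * Q by ring, hQ,
        Finset.mul_sum, Finset.mul_sum]
      exact Finset.sum_congr rfl fun x _ => by ring
    have hlin : linObs (-1) N φt =
        C (-Complex.I * ((t : ℝ) : ℂ)) * MvPolynomial.map Complex.ofRealHom (field ℓ) := by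
      rw [hφt]
      have := linObs_negOne_I (ν := ν) (L := L) N (fun y => t * φ y)
      rw [show (fun y : TorusSite ν L => (((t * φ y : ℝ)) : ℂ) * Complex.I) =
          fun y => (((fun y => t * φ y) y : ℝ) : ℂ) * Complex.I from rfl, this]
      have : (fun x => (N : ℝ) * stencil 1 (fun y => t * φ y) x) = fun x => t * ℓ x := by
        funext x; rw [stencil_smul, hℓ]; ring
      rw [this, field_smul, map_mul, map_C, ← mul_assoc, ← map_mul]
      rfl
    rw [hg, hlin, bracketC_eT_C_mul_map_field, norm_mul, Complex.norm_exp, Complex.ofReal_re,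
      Complex.norm_real, Real.norm_of_nonneg hZ0] at hgd
    -- pass to the real part
    have hre : (∑ n ∈ range (topDegree ν L N + 1), (-Complex.I * ((t : ℝ) : ℂ)) ^ n *
        ((bracket N m a (field ℓ ^ n) / (n.factorial : ℝ) : ℝ) : ℂ)).re =
        ∑ n ∈ range (topDegree ν L N + 1), p n * t ^ n := by
      rw [Complex.re_sum]
      refine Finset.sum_congr rfl fun n _ => ?_
      rw [hp, mul_pow, ← Complex.ofReal_pow, mul_assoc, ← Complex.ofReal_mul, Complex.re_mul_ofReal]
      ring
    have hexp : 0 < Real.exp (-((N : ℝ) / 2) * Q * t ^ 2) := Real.exp_pos _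
    have hle := (mul_le_mul_of_nonneg_left (Complex.abs_re_le_norm _) hexp.le).trans hgd
    rw [hre] at hle
    rw [hp0]
    have h3 := (le_div_iff₀' hexp).2 hle
    rw [div_eq_mul_inv, ← Real.exp_neg,
      show -(-((N : ℝ) / 2) * Q * t ^ 2) = (N : ℝ) / 2 * Q * t ^ 2 by ring] at h3
    calc |∑ n ∈ range (topDegree ν L N + 1), p n * t ^ n|
        ≤ partitionFunction (ν := ν) (L := L) N m a * Real.exp ((N : ℝ) / 2 * Q * t ^ 2) := h3
      _ = Z * Real.exp ((N : ℝ) / 2 * Q * t ^ 2) := by rw [hZdef]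
  have h2 := coeff_two_le_of_abs_sum_le_exp (le_trans (by omega) hD2) p
    (by positivity : 0 ≤ (N : ℝ) / 2 * Q) (by rw [hp0]; exact hZ0) hbound
  rw [hp0] at h2
  have hI2 : ((-Complex.I) ^ 2).re = -1 := by
    rw [neg_sq, Complex.I_sq]; simp
  simp only [hp, hI2, Nat.factorial_two, Nat.cast_ofNat] at h2
  have hℓ2 : bracket N m a (field ℓ ^ 2) = (N : ℝ) ^ 2 * bracket N m a (field (stencil 1 φ) ^ 2) := by
    rw [hℓ, field_smul, mul_pow, ← map_pow, bracket_C_mul]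
  rw [hℓ2] at h2
  have h3 : (N : ℝ) * (-bracket N m a (field (stencil 1 φ) ^ 2)) ≤ Q * Z :=
    le_of_mul_le_mul_left (by linarith) hNpos
  have h4 : -bracket N m a (field (stencil 1 φ) ^ 2) ≤ Q * Z / N := (le_div_iff₀' hNpos).2 h3
  have h5 : (1 : ℝ) / N * Q * Z = Q * Z / N := by ring
  rw [h5]
  linarith

end ComplexSpin

/-! ### The infrared bound -/

open ComplexSpin in
/-- **Theorem 3.21 of Salmhofer–Seiler (Infrared Bound) — discharge of the cited fact
`SalmhoferSeiler1991_infraredBound`.**  For the complex spin system on the even torus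
`(ℤ/Lℤ)^ν` (`L ≥ 4`) with site weight `F(z) = e^{2Nmz}`, bond data `a` (`a_0 = 1`, `a_1 = N`) and
`b_k ≥ 0` for `k ≤ N`: `⟨σ(h)σ(-Δh)⟩_Λ ≤ N⁻¹‖h‖²` (3.74) and `⟨σ(h)σ(Δ̄h)⟩_Λ ≥ -N⁻¹‖h‖²` (3.75)
for all real `h`.  Proof as printed (pp. 413–415): reflection positivity of the background bracket
(Prop. 3.15, `ComplexSpinReflectionPositivity`), Thm. 3.20 (`ComplexSpinExponentialSchwarz`), the
chessboard bound and Gaussian domination (3.79)–(3.97) (`ComplexSpinChessboard`,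
`ComplexSpinGaussianDomination`), the identification (3.81)–(3.83)
(`ComplexSpinTwistedPartitionFunction`), the second order of (3.98)–(3.99) and "the rest of the
proof … similar to [18]" (`InfraredBoundSpectralStep`). [cite: SalmhoferSeiler1991, Thm. 3.21] -/
theorem SalmhoferSeiler1991_infraredBound_holds : SalmhoferSeiler1991_infraredBound := by
  intro ν L N _ hL hL4 hN m a _ _ hb h
  have hNpos : (0 : ℝ) < N := Nat.cast_pos.2 hN
  have hnorm : 0 ≤ normSq h := normSq_nonneg h
  rcases Nat.eq_zero_or_pos ν with hν | hν
  · -- `ν = 0`: no links, `Δ = Δ̄ = 0`, both expectations vanish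
    subst hν
    have hlap : (fun x => -laplacian h x) = fun _ => (0 : ℝ) := by
      funext x; simp [laplacian]
    have haf : afLaplacian h = fun _ => (0 : ℝ) := by
      funext x; simp [afLaplacian]
    have hf0 : field (fun _ : TorusSite 0 L => (0 : ℝ)) = 0 := by simp [field]
    rw [hlap, haf, hf0, mul_zero, expect_eq_div, bracket, zero_mul, coeff_zero, zero_div]
    constructor
    · positivity
    · have : 0 ≤ 1 / (N : ℝ) * normSq h := by positivity
      linarith
  · -- `ν ≥ 1`
    set i : Fin ν := ⟨0, hν⟩
    have hcard : 2 ≤ Fintype.card (TorusSite ν L) := by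
      rw [Fintype.card_fun, ZMod.card, Fintype.card_fin]
      calc 2 ≤ L := by omega
        _ ≤ L ^ ν := Nat.le_self_pow (by omega) L
    set Z : ℝ := partitionFunction (ν := ν) (L := L) N m a with hZdef
    have hZ0 : 0 ≤ Z := (partitionFunction_nonneg' hL i hcard 1 (Or.inl rfl) m hb).1
    set G : TorusSite ν L → TorusSite ν L → ℝ := fun x y => bracket N m a (X x * X y) with hG
    have hT : ∀ x y c : TorusSite ν L, G (x + c) (y + c) = G x y :=
      fun x y c => bracket_X_mul_X_add N m a x y c
    have hS : ∀ x y : TorusSite ν L, G x y = G y x := fun x y => bracket_X_mul_X_comm N m a x y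
    have hκ : 0 ≤ 1 / (N : ℝ) * Z := by positivity
    constructor
    · -- (3.74)
      have hA : ∀ φ : TorusSite ν L → ℝ,
          ∑ x, ∑ y, stencil (-1) φ x * G x y * stencil (-1) φ y ≤
            (1 / (N : ℝ) * Z) * ∑ x, φ x * stencil (-1) φ x := by
        intro φ
        have h1 := bracket_sq_field_stencil_negOne_le hL i hcard hN m hb φ
        rw [sq, bracket_field_mul_field] at h1
        linarith
      have hB := form_le_of_stencil_form_le (s := -1) (by norm_num) hT hS hκ hA h
      rw [← bracket_field_mul_field] at hB
      have hfun : field (stencil (-1) h) = field (ν := ν) (L := L) fun x => -laplacian h x := by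
        congr 1; funext x; exact stencil_neg_one h x
      rw [hfun] at hB
      rw [expect_eq_div, normSq]
      rcases hZ0.lt_or_eq with hZpos | hZ00
      · rw [div_le_iff₀ hZpos]; linarith
      · rw [← hZdef, ← hZ00, div_zero]; positivity
    · -- (3.75)
      have hT' : ∀ x y c : TorusSite ν L, (fun x y => -G x y) (x + c) (y + c) = (fun x y => -G x y) x y :=
        fun x y c => by simp only [hT]
      have hS' : ∀ x y : TorusSite ν L, (fun x y => -G x y) x y = (fun x y => -G x y) y x :=
        fun x y => by simp only [hS x y]
      have hA : ∀ φ : TorusSite ν L → ℝ,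
          ∑ x, ∑ y, stencil 1 φ x * (fun x y => -G x y) x y * stencil 1 φ y ≤
            (1 / (N : ℝ) * Z) * ∑ x, φ x * stencil 1 φ x := by
        intro φ
        have h1 := neg_le_bracket_sq_field_stencil_one hL i hcard hN m hb φ
        rw [sq, bracket_field_mul_field] at h1
        have : ∑ x, ∑ y, stencil 1 φ x * (fun x y => -G x y) x y * stencil 1 φ y =
            -∑ x, ∑ y, stencil 1 φ x * G x y * stencil 1 φ y := by
          rw [← Finset.sum_neg_distrib]
          refine Finset.sum_congr rfl fun x _ => ?_
          rw [← Finset.sum_neg_distrib]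
          exact Finset.sum_congr rfl fun y _ => by ring
        rw [this]
        linarith
      have hB := form_le_of_stencil_form_le (s := 1) (by norm_num) hT' hS' hκ hA h
      have : ∑ x, ∑ y, h x * (fun x y => -G x y) x y * stencil 1 h y =
          -∑ x, ∑ y, h x * G x y * stencil 1 h y := by
        rw [← Finset.sum_neg_distrib]
        refine Finset.sum_congr rfl fun x _ => ?_
        rw [← Finset.sum_neg_distrib]
        exact Finset.sum_congr rfl fun y _ => by ring
      rw [this, ← bracket_field_mul_field] at hB
      have hfun : field (stencil 1 h) = field (ν := ν) (L := L) (afLaplacian h) := by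
        congr 1; funext x; exact stencil_one h x
      rw [hfun] at hB
      rw [expect_eq_div, normSq]
      rcases hZ0.lt_or_eq with hZpos | hZ00
      · rw [le_div_iff₀ hZpos]; linarith
      · rw [← hZdef, ← hZ00, div_zero]
        have : 0 ≤ 1 / (N : ℝ) * ∑ x, h x ^ 2 := by positivity
        linarith

open ComplexSpin in
/-- **The infrared bound for the `U(N)` lattice gauge theory at `β = 0`, unconditionally** (every
`N ≥ 1`, even torus `L ≥ 4`): Thm. 3.21 with Remark 4.5 (`b_k ≥ 0` for the `U(N)` bond data,
proved in `ComplexSpinInfraredBound`). [cite: SalmhoferSeiler1991, Thm. 3.21 with Remark 4.5] -/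
theorem uN_infraredBound (ν L N : ℕ) [NeZero L] (hL : Even L) (hL4 : 4 ≤ L) (hN1 : 1 ≤ N)
    (m : ℝ) (f : TorusSite ν L → ℝ) :
    expect N m (uNBondCoeff N) (field f * field fun x => -laplacian f x) ≤ (1 / N) * normSq f ∧
      -((1 / N) * normSq f) ≤ expect N m (uNBondCoeff N) (field f * field (afLaplacian f)) :=
  SalmhoferSeiler1991_infraredBound.uN SalmhoferSeiler1991_infraredBound_holds ν L N hL hL4 hN1 m f

open ComplexSpin in
/-- **The infrared bound for the NJL system / strongly coupled QED, unconditionally** (Thm. 3.21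
with Remark 3.22: `V = 0`, `b_k = δ_{k0}`). [cite: SalmhoferSeiler1991, Thm. 3.21 with Remark 3.22] -/
theorem njl_infraredBound (ν L N : ℕ) [NeZero L] (hL : Even L) (hL4 : 4 ≤ L) (hN1 : 1 ≤ N)
    (m : ℝ) (f : TorusSite ν L → ℝ) :
    expect N m (njlBondCoeff N) (field f * field fun x => -laplacian f x) ≤ (1 / N) * normSq f ∧
      -((1 / N) * normSq f) ≤ expect N m (njlBondCoeff N) (field f * field (afLaplacian f)) :=
  SalmhoferSeiler1991_infraredBound.njl SalmhoferSeiler1991_infraredBound_holds ν L N hL hL4 hN1 m f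

end Literature.MathematicalPhysics.StatisticalMechanics

end
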